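import Summits.BirchSwinnertonDyer.BirchSwinnertonDyer.Theses.KatoDescentTamePotSupersingular
import Summits.BirchSwinnertonDyer.Rank1Residual.O6.X3WildOfKMCTorsionFreeMember
import HarnessLib

/-!
# Route `KatoDescentTamePotSupersingular` (rung K8, sub-rung B4 (t′), cell `bsd-potss`): the declared
# residual `TameRankOne` (item stmt-BirchSwinnertonDyer-19984) FROM KMC_p ⊕ PR^× at the p-torsion-free
# members, over the image-free readings — the route's rank-one DescentGlue (a `--supports … --as helper` file)

Route file: "`TameRankOne` … (KMC_p + the Perrin-Riou / Burns–Kurihara–Sano Conj. 1.5 reading up to a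
unit — tree `o5Sharp_of_kmc_torsionFree` restricted to (t′) …)". This file performs exactly that
restriction: seat kmc's part 10 theorem `o5Sharp_of_kmc_torsionFree` (p408212) gives the leaf `O5Sharp`
(both tame cells, analytic rank `≤ 1`) from KMC_p ⊕ PR^× at ONE `p`-torsion-free member of each O5 class
(such members exist: Mazur–Kenku walk) over part 8a's readings, the interface lemma `ReadsTrivialKMC`,
and Cassels, GZK, modularity, Mazur–Kenku; a (t′) pair is an O5 pair (`ClassO5 := ⟨p ≠ 2, Addv, Or.inr
SubTprime⟩`), so the analytic-rank-one (t′) rows follow. CONDITIONAL (audit `proof.conditional`); the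
item is NOT closed. Seat `bsd-potss-kmc` generation 6.

References: [Kato2004Asterisque] Conj. 12.10 (p. 224), §14.14 (p. 243), Prop. 14.16 (p. 244);
[BurnsKuriharaSano2019] Conj. 1.5, Thm. 7.3, Thm. 7.6; [SilvermanAEC2009] IX.6 Ex. 6.4.
-/

set_option autoImplicit false
-- sibling precedent (`KatoDescentPotSupersingularAssembly.lean`): the directory name repeats the summit name
set_option linter.dupNamespace false

noncomputable section

open scoped Classical

namespace Summit.BirchSwinnertonDyer.BirchSwinnertonDyer.Theorems

open WeierstrassCurve Literature.NumberTheory.EllipticCurves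
  Literature.NumberTheory.EllipticCurves.Rank1Residual
  Literature.NumberTheory.EllipticCurves.Rank1Residual.Typed
  Summit.BirchSwinnertonDyer.Rank1Residual.Additive
  Summit.BirchSwinnertonDyer.Rank1Residual
  Summit.BirchSwinnertonDyer.BirchSwinnertonDyer.Theses.KatoDescentTamePotSupersingular

variable {IsOf : ∀ (W : WeierstrassCurve ℚ) [W.IsElliptic] [W.IsGloballyMinimal] (p : ℕ) [Fact p.Prime],
  KatoDescentDatum p → Prop}
variable {PRRatio : ∀ (W : WeierstrassCurve ℚ) [W.IsElliptic] [W.IsGloballyMinimal] (p : ℕ)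
  [Fact p.Prime], ℚ_[p] → Prop}
variable {KMC : ∀ (W : WeierstrassCurve ℚ) [W.IsElliptic] [W.IsGloballyMinimal] (p : ℕ), Prop}

/-- **Rank-one DescentGlue for the K8(t′) residual `TameRankOne`**: KMC_p ⊕ (in rank one) PR^× at the
`p`-torsion-free members of each O5 class (hypothesis `hK`, the binder of `o5Sharp_of_kmc_torsionFree`),
over the image-free readings, Cassels, GZK, modularity and Mazur–Kenku ⟹ `TameRankOne` (type = the route
decl verbatim): the analytic-rank-one (t′) slice of `O5Sharp`. Conditional over displayed hypotheses;
nothing about Kato's objects or Perrin-Riou's conjecture is asserted; the item is not closed.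
[cite: Kato2004Asterisque, Conj. 12.10 (p. 224), §14.14 (p. 243), Prop. 14.16 (2) (p. 244)]
[cite: BurnsKuriharaSano2019, Conj. 1.5, Thm. 7.3 (p. 29)] [cite: SilvermanAEC2009, IX.6 Example 6.4] -/
theorem tameRankOne_of_kmc_perrinRiou_torsionFree (hR : TorsionFree.DescentCountReading IsOf)
    (hC : TorsionFree.RankOneCountReading IsOf PRRatio) (hreal : TorsionFree.RealizableOfKMC IsOf KMC)
    (hread : ReadsTrivialKMC IsOf KMC) (hCassels : bsdRHS_eq_of_isIsogenous)
    (hGZK : rank_eq_analyticRank_of_analyticRank_le_one) (hmod : hasEntireLFunction_rat)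
    (hMK : mazurKenku_exists_cyclic_isogeny)
    (hK : ∀ (W W' : WeierstrassCurve ℚ) [W.IsElliptic] [W.IsGloballyMinimal] [W'.IsElliptic]
      [W'.IsGloballyMinimal] (p : ℕ) [Fact p.Prime],
      W.analyticRank ≤ 1 → ClassO5 W p → IsIsogenous W W' → Addv W' p → 0 ≤ padicValRat p W'.j →
        ¬ p ∣ W'.torsionOrder → KMC W' p ∧ (W'.analyticRank = 1 → PerrinRiouUpToUnitAt PRRatio W' p)) :
    Summit.BirchSwinnertonDyer.BirchSwinnertonDyer.Theses.KatoDescentTamePotSupersingular.TameRankOne := by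
  intro W _ _ p _ hr hp2 hadd hT
  have hO5 : ClassO5 W p := ⟨hp2, hadd, Or.inr hT⟩
  exact o5Sharp_of_kmc_torsionFree hR hC hreal hread hCassels hGZK hmod hMK hK W p (le_of_eq hr) hO5

end Summit.BirchSwinnertonDyer.BirchSwinnertonDyer.Theorems

end
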